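import Summits.BirchSwinnertonDyer.BirchSwinnertonDyer.Theorems.PrintX10bStubAH4AtSOfExactAtP
import Summits.BirchSwinnertonDyer.BirchSwinnertonDyer.Theorems.PrintX9MuPartStubH5bAtSERedOfClauseZero
import Summits.BirchSwinnertonDyer.BirchSwinnertonDyer.Theorems.PrintX9MuPartStubAKSLinkOfPrint
import HarnessLib

/-!
# STUB A of the shared μ-crux `MuInequalityCoherentPairOfPrintCG` (stmt-BirchSwinnertonDyer-23428), ASSEMBLED and importable:
# `thm411 → Stmt.howardInputsCore` from (Exact) at `v ∣ p` and the level-`0` clause of H.5(b) at `v ∣ p` (helper)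

Summits-side helper of the line `spec_witnesses` (skeleton v8, μ-LEAD `bsd-line-x9-p1` g4; `--supports` stmt-BirchSwinnertonDyer-23428).
Letters (`abbrev … : Prop`, copied VERBATIM from the registered skeleton / the landed files, `ctrlLevel` inlined) + theorems; no
named fact, no instance, no `sorry`.

The registered skeleton (HOME `pub/bsd-print-x9/p1/Skeleton-SharedMu-SpecWitnesses-v8.lean`, evidence on 23428) derives Howard's
inputs for the Eisenstein DVR settings `S_m` of `E_K` — `Stmt.howardInputs = thm411 → Stmt.howardInputsCore` (H.0–H.5 +
`LargePrimes` + a Kolyvagin system whose bottom class is the compact control image of the stabilised class, non-zero, for `m ≫ 0`)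
— by D1's `obtain` chain (bsd-line-x10b-p1 LEAD g8, `D1_STUB_A_ASSEMBLY` v3, crux workfile `Cruxes/BeyondCarrierDepthX10b/…`,
commit 1bc7e550c580) from four inputs.  This file puts that chain IN THE TREE so the closing file of the crux only imports it:
* `Stmt.h5bAtS` (D1 v3 letter, `he_red` binder), `Stmt.h5bAtSZeroP` (x10b-p1-w8 g3's level-`0` clause, p670626), `Stmt.ksLink`,
  `Stmt.howardInputsCore`, `Stmt.howardInputs` (skeleton v8 letters; `Stmt.h4AtS`/`Stmt.exactAtP`/`Stmt.poitouTate` are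
  `HeegnerMuPartH4AtS.*` of p672535, not restated);
* **`howardInputs_of_clauses`** — D1's chain VERBATIM (KS side: `S`, `π`, `𝓛`, `t`, `I`, `jbar′`; frame: canonical conjugation datum,
  H.4 data and `SatisfiesH` modulo the `v ∈ S` clauses by `exists_eisensteinSettingData_satisfiesH_eRed_of_thm413Hypotheses`
  (p670309); `LargePrimes` by `eisensteinDVRSetting_largePrimes`), exporting the place-set discipline `hSN`/`hSσ`;
* **`howardInputs_of_exactAtP_of_clauseZeroP`** — `Stmt.exactAtP → Stmt.h5bAtSZeroP → Stmt.howardInputs`: Poitou–Tate is the kernel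
  theorem `HeegnerMuPartH4AtS.poitouTate_holds`, H.4 ⟸ (Exact) by `h4AtS_of_exactAtP'` (p672535), H.5(b) ⟸ its level-`0` clause by
  `HeegnerMuPartH5bAtS.h5bAtSERed_of_clauseZeroP` (p672403), the KS-LINK by `HeegnerMuPartKSLink.ksLink_of_thm411` (p666139).
So the two registered STUB-A stubs of v8 (`stub_exactAtP`, `stub_h5bAtSZeroP`) are exactly what remains of Howard's hypotheses.
HONEST FRAMING: nothing here proves (Exact) at `v ∣ p` or the anomalous H.5(b) clause; no summit statement is proved; the μ-crux is
not asserted; BSD is not proved by any of this.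

References: [Howard2004HeegnerKolyvagin] §1.3 H.0–H.5, Thm. 1.6.1, §2.2–§2.3, proof of Thm. 2.2.10; [CastellaGrossiLeeSkinner2022]
Thm. 4.1.1, §3.2, §3.4; [MilneADT2006] I Thm. 4.10.
-/

set_option linter.dupNamespace false
set_option autoImplicit false

noncomputable section

open scoped Classical Pointwise ContRepresentation TensorProduct NumberField

open Function NumberField IsDedekindDomain Field
open Literature Literature.NumberTheory.EllipticCurves WeierstrassCurve
open Literature.NumberTheory.GaloisCohomology Literature.NumberTheory.GaloisCohomology.Howard2004
open Literature.NumberTheory.Automorphic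
open Literature.NumberTheory.EllipticCurves.ZpExtension (EisensteinLevel)
open Literature.NumberTheory.GaloisRepresentations Literature.NumberTheory.GaloisRepresentations.DiscreteGaloisModule
open Summit.BirchSwinnertonDyer.BirchSwinnertonDyer.Theorems

namespace Summit.BirchSwinnertonDyer.BirchSwinnertonDyer.Theorems.HeegnerMuPartStubA

set_option synthInstance.maxHeartbeats 80000 in
/-- INPUT 3 — **H.5(b) at the places of `S`** for the same data (pins `π`, `jbar′` arbitrary), `m ≫ 0` allowed. -/
abbrev Stmt.h5bAtS : Prop :=
  ∀ (N : ℕ) [NeZero N] (W : WeierstrassCurve ℚ) [W.IsGloballyMinimal] (K : Type) [Field K] [NumberField K]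
    (p : ℕ) [Fact p.Prime] (κ : ZpExtension K p) (γ : Field.absoluteGaloisGroup K)
    (hyp : CastellaGrossiLeeSkinner2022.Thm413Hypotheses N W K p κ γ),
    W.HasIrreducibleModPGaloisRep p → (W.baseChange K).HasIrreducibleModPGaloisRep p →
    haveI := hyp.isElliptic
    ∀ (S : Finset (HeightOneSpectrum (𝓞 K)))
      (hpS : ∀ v, ((p : ℕ) : 𝓞 K) ∈ v.asIdeal → v ∈ S)
      (hbad : ∀ v, v ∉ S → ((p : ℕ) : 𝓞 K) ∉ v.asIdeal → (W.baseChange K).HasGoodReductionAt v),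
    (∀ v ∈ S, ((p : ℕ) : 𝓞 K) ∈ v.asIdeal ∨ ((N : ℕ) : 𝓞 K) ∈ v.asIdeal) →
    (∀ (σ : K ≃ₐ[ℚ] K) (v : HeightOneSpectrum (𝓞 K)), σ • v ∈ S → v ∈ S) →
    ∃ m₅ : ℕ, ∀ (m : ℕ) (hm : 1 ≤ m), m₅ ≤ m →
      letI := IwasawaAlgebra.isDomain_quotient_X_pow_add_C p hm
      letI := IwasawaAlgebra.isDiscreteValuationRing_quotient_X_pow_add_C p hm
      haveI := IwasawaAlgebra.EisensteinCoeff.isLocalRing_succ p hm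
      letI := IwasawaAlgebra.EisensteinCoeff.algebraOfSpecSucc p m
      haveI := W.isScalarTower_algebraOfSpecSucc (K := K) (p := p) (m := m)
      letI := W.residueModuleSucc (K := K) (p := p) hm
      ∀ (π : ∀ v : HeightOneSpectrum (𝓞 K), TamePin v) (L : Set (HeightOneSpectrum (𝓞 K)))
        (hL : L ⊆ (W.eisensteinTower (κ.unitTwist (-1)) hm).degreeTwoPrimes p) (hLS : ∀ v ∈ L, v ∉ S)
        (jbar' : AlgebraicClosure K →+* ℂ)
        (c₀ : absoluteGaloisGroup ℚ) (σ : K ≃ₐ[ℚ] K) (hσ₁ : σ ≠ 1) (hσ : σ * σ = 1)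
        (hτl : IsLiftOfAut σ (absGaloisTransport (K := ℚ) (L := K) c₀).toRingEquiv)
        (hτ₂ : Function.Involutive (absGaloisTransport (K := ℚ) (L := K) c₀).toRingEquiv)
        (D : ∀ k, DualityDatum p (ConjugationDatum.ofLifts σ hσ₁ hσ _ hτl hτ₂)
          ((W.eisensteinTower (κ.unitTwist (-1)) hm).ρ k) (IwasawaAlgebra.EisensteinCoeff p m (k + 1)))
        (e : ∀ j : ℕ, geomTorsion (W.baseChange K) ((p : ℤ) ^ j) →+ geomTorsion (W.baseChange K) ((p : ℤ) ^ j) →+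
          MuCarrier K (p ^ j))
        (log : ∀ j : ℕ, MuCarrier K (p ^ j) →+ ZMod (p ^ j)),
        IsComplexConjugation (Rat.castHom ℝ) c₀ →
        (∀ x, (ConjugationDatum.ofLifts σ hσ₁ hσ _ hτl hτ₂).τ x = absGaloisTransport (K := ℚ) (L := K) c₀ x) →
        (∀ k, (D k).e = ZpExtension.eisensteinDualityForm hm (k + 1)
          (conjPairing (e (k + 1)) ((ConjugationDatum.ofLifts σ hσ₁ hσ _ hτl hτ₂).isLift.torsionMap W _)
            (log (k + 1)))) →
        (∀ k (x y : EisensteinLevel p m (fun j ↦ geomTorsion (W.baseChange K) ((p : ℤ) ^ j)) (k + 1 + 1)),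
          IwasawaAlgebra.EisensteinCoeff.reduce p m (Nat.le_succ (k + 1)) ((D (k + 1)).e x y) =
            (D k).e ((W.eisensteinTower (κ.unitTwist (-1)) hm).red k x) ((W.eisensteinTower (κ.unitTwist (-1)) hm).red k y)) →
        (∀ j a, e j a a = 0) →
        (∀ j (g : absoluteGaloisGroup K) a b, e j (g • a) (g • b) = mu K (p ^ j) g (e j a b)) →
        (∀ j a b, e j ((ConjugationDatum.ofLifts σ hσ₁ hσ _ hτl hτ₂).isLift.torsionMap W _ a)
          ((ConjugationDatum.ofLifts σ hσ₁ hσ _ hτl hτ₂).isLift.torsionMap W _ b) = -e j a b) →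
        (∀ j (a : geomTorsion (W.baseChange K) ((p : ℤ) ^ j)),
          (ConjugationDatum.ofLifts σ hσ₁ hσ _ hτl hτ₂).isLift.torsionMap W _
            ((ConjugationDatum.ofLifts σ hσ₁ hσ _ hτl hτ₂).isLift.torsionMap W _ a) = a) →
        (∀ j, Function.Bijective (log j)) →
        (∀ j (g : absoluteGaloisGroup K) ξ, log j (mu K (p ^ j) g ξ) = cyclotomicCharacterModPow K p j g * log j ξ) →
        ∀ k, ∀ v ∈ S,
          (((W.isQuotientBy_eisensteinDVRSetting_πbar (κ.unitTwist (-1)) hm S hpS hbad L hL hLS jbar'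
              (ConjugationDatum.ofLifts σ hσ₁ hσ _ hτl hτ₂) D
              (W.eisensteinLevelsTameFs (κ.unitTwist (-1)) hm π S hpS hbad L hL hLS)
              k).propagateStructure (W.eisensteinTowerTriple (κ.unitTwist (-1)) hm S hpS hbad L hL hLS k).cond)
              (Sum.inr (σ • v))).map
              (((W.residualTauGeomTorsion (p := p) (ConjugationDatum.ofLifts σ hσ₁ hσ _ hτl hτ₂) hm (k := k + 1)
                  k.succ_pos).thetaH1 (Sum.inr v)).comp
                ((ConjugationDatum.ofLifts σ hσ₁ hσ _ hτl hτ₂).transportH1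
                  ((W.baseChange K).torsionGaloisModule (p : ℤ)) v)) =
            ((W.isQuotientBy_eisensteinDVRSetting_πbar (κ.unitTwist (-1)) hm S hpS hbad L hL hLS jbar'
              (ConjugationDatum.ofLifts σ hσ₁ hσ _ hτl hτ₂) D
              (W.eisensteinLevelsTameFs (κ.unitTwist (-1)) hm π S hpS hbad L hL hLS)
              k).propagateStructure (W.eisensteinTowerTriple (κ.unitTwist (-1)) hm S hpS hbad L hL hLS k).cond)
              (Sum.inr v)

set_option synthInstance.maxHeartbeats 80000 in
/-- INPUT 3′ — **the level-`0` clause of H.5(b) at ONE place `v ∈ S` above `p`**, `∃ m₁ ∀ m > m₁` before the data (x10b-p1-w8 g3's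
`H5P` binder of `HeegnerMuPartH5bAtS.h5bAtS_of_clauseZeroP`, p670626, VERBATIM): `Stmt.h5bAtS` FOLLOWS from it (the places prime
to `p` and the level lift are in the tree). -/
abbrev Stmt.h5bAtSZeroP : Prop :=
  ∀ (N : ℕ) [NeZero N] (W : WeierstrassCurve ℚ) [W.IsGloballyMinimal] (K : Type) [Field K] [NumberField K]
    (p : ℕ) [Fact p.Prime] (κ : ZpExtension K p) (γ : Field.absoluteGaloisGroup K)
    (hyp : CastellaGrossiLeeSkinner2022.Thm413Hypotheses N W K p κ γ),
    W.HasIrreducibleModPGaloisRep p → (W.baseChange K).HasIrreducibleModPGaloisRep p →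
    haveI := hyp.isElliptic
    ∀ (S : Finset (HeightOneSpectrum (𝓞 K)))
      (hpS : ∀ v, ((p : ℕ) : 𝓞 K) ∈ v.asIdeal → v ∈ S)
      (hbad : ∀ v, v ∉ S → ((p : ℕ) : 𝓞 K) ∉ v.asIdeal → (W.baseChange K).HasGoodReductionAt v),
    (∀ v ∈ S, ((p : ℕ) : 𝓞 K) ∈ v.asIdeal ∨ ((N : ℕ) : 𝓞 K) ∈ v.asIdeal) →
    (∀ (σ : K ≃ₐ[ℚ] K) (v : HeightOneSpectrum (𝓞 K)), σ • v ∈ S → v ∈ S) →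
    ∀ v ∈ S, ((p : ℕ) : 𝓞 K) ∈ v.asIdeal →
    ∃ m₁ : ℕ, ∀ (m : ℕ) (hm : 1 ≤ m), m₁ < m →
      letI := IwasawaAlgebra.isDomain_quotient_X_pow_add_C p hm
      letI := IwasawaAlgebra.isDiscreteValuationRing_quotient_X_pow_add_C p hm
      haveI := IwasawaAlgebra.EisensteinCoeff.isLocalRing_succ p hm
      letI := IwasawaAlgebra.EisensteinCoeff.algebraOfSpecSucc p m
      haveI := W.isScalarTower_algebraOfSpecSucc (K := K) (p := p) (m := m)
      letI := W.residueModuleSucc (K := K) (p := p) hm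
      ∀ (π : ∀ v : HeightOneSpectrum (𝓞 K), TamePin v) (L : Set (HeightOneSpectrum (𝓞 K)))
        (hL : L ⊆ (W.eisensteinTower (κ.unitTwist (-1)) hm).degreeTwoPrimes p) (hLS : ∀ v ∈ L, v ∉ S)
        (jbar' : AlgebraicClosure K →+* ℂ)
        (c₀ : absoluteGaloisGroup ℚ) (σ : K ≃ₐ[ℚ] K) (hσ₁ : σ ≠ 1) (hσ : σ * σ = 1)
        (hτl : IsLiftOfAut σ (absGaloisTransport (K := ℚ) (L := K) c₀).toRingEquiv)
        (hτ₂ : Function.Involutive (absGaloisTransport (K := ℚ) (L := K) c₀).toRingEquiv)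
        (D : ∀ k, DualityDatum p (ConjugationDatum.ofLifts σ hσ₁ hσ _ hτl hτ₂)
          ((W.eisensteinTower (κ.unitTwist (-1)) hm).ρ k) (IwasawaAlgebra.EisensteinCoeff p m (k + 1)))
        (e : ∀ j : ℕ, geomTorsion (W.baseChange K) ((p : ℤ) ^ j) →+ geomTorsion (W.baseChange K) ((p : ℤ) ^ j) →+
          MuCarrier K (p ^ j))
        (log : ∀ j : ℕ, MuCarrier K (p ^ j) →+ ZMod (p ^ j)),
        IsComplexConjugation (Rat.castHom ℝ) c₀ →
        (∀ x, (ConjugationDatum.ofLifts σ hσ₁ hσ _ hτl hτ₂).τ x = absGaloisTransport (K := ℚ) (L := K) c₀ x) →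
        (∀ k, (D k).e = ZpExtension.eisensteinDualityForm hm (k + 1)
          (conjPairing (e (k + 1)) ((ConjugationDatum.ofLifts σ hσ₁ hσ _ hτl hτ₂).isLift.torsionMap W _)
            (log (k + 1)))) →
        (∀ j a, e j a a = 0) →
        (∀ j (g : absoluteGaloisGroup K) a b, e j (g • a) (g • b) = mu K (p ^ j) g (e j a b)) →
        (∀ j a b, e j ((ConjugationDatum.ofLifts σ hσ₁ hσ _ hτl hτ₂).isLift.torsionMap W _ a)
          ((ConjugationDatum.ofLifts σ hσ₁ hσ _ hτl hτ₂).isLift.torsionMap W _ b) = -e j a b) →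
        (∀ j (a : geomTorsion (W.baseChange K) ((p : ℤ) ^ j)),
          (ConjugationDatum.ofLifts σ hσ₁ hσ _ hτl hτ₂).isLift.torsionMap W _
            ((ConjugationDatum.ofLifts σ hσ₁ hσ _ hτl hτ₂).isLift.torsionMap W _ a) = a) →
        (∀ j, Function.Bijective (log j)) →
        (∀ j (g : absoluteGaloisGroup K) ξ, log j (mu K (p ^ j) g ξ) = cyclotomicCharacterModPow K p j g * log j ξ) →
          (((W.isQuotientBy_eisensteinDVRSetting_πbar (κ.unitTwist (-1)) hm S hpS hbad L hL hLS jbar'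
              (ConjugationDatum.ofLifts σ hσ₁ hσ _ hτl hτ₂) D
              (W.eisensteinLevelsTameFs (κ.unitTwist (-1)) hm π S hpS hbad L hL hLS)
              0).propagateStructure (W.eisensteinTowerTriple (κ.unitTwist (-1)) hm S hpS hbad L hL hLS 0).cond)
              (Sum.inr (σ • v))).map
              (((W.residualTauGeomTorsion (p := p) (ConjugationDatum.ofLifts σ hσ₁ hσ _ hτl hτ₂) hm (k := 0 + 1)
                  (Nat.succ_pos 0)).thetaH1 (Sum.inr v)).comp
                ((ConjugationDatum.ofLifts σ hσ₁ hσ _ hτl hτ₂).transportH1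
                  ((W.baseChange K).torsionGaloisModule (p : ℤ)) v)) =
            ((W.isQuotientBy_eisensteinDVRSetting_πbar (κ.unitTwist (-1)) hm S hpS hbad L hL hLS jbar'
              (ConjugationDatum.ofLifts σ hσ₁ hσ _ hτl hτ₂) D
              (W.eisensteinLevelsTameFs (κ.unitTwist (-1)) hm π S hpS hbad L hL hLS)
              0).propagateStructure (W.eisensteinTowerTriple (κ.unitTwist (-1)) hm S hpS hbad L hL hLS 0).cond)
              (Sum.inr v)

set_option synthInstance.maxHeartbeats 80000 in
/-- INPUT 4 — **the Kolyvagin system with the LINK**, `m ≫ 0`: the KS side chooses the place set `S` (⊇ places above `p`,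
⊆ places above `pN`, `Aut(K/ℚ)`-stable — e.g. `placesDividing K (p * N)` of (F-411)), the pins `π`, the prime set `𝓛` (off `S`,
inside the degree-two primes, containing `𝓛_{s₁}(T_𝔮) ∖ S` for the `LargePrimes` witness), the tower pin `(t, ht, I)` and
`jbar′`, and then, for ANY conjugation datum / H.4 data and any `hy`, produces `κKS` with bottom class the control image of `z`,
nonzero (the same binder prefix as the letter). -/
abbrev Stmt.ksLink : Prop :=
  ∀ (N : ℕ) [NeZero N] (W : WeierstrassCurve ℚ) [W.IsGloballyMinimal] (K : Type) [Field K] [NumberField K]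
    (p : ℕ) [Fact p.Prime] (κ : ZpExtension K p) (γ : Field.absoluteGaloisGroup K)
    (jbar : AlgebraicClosure K →+* ℂ) (hyp : CastellaGrossiLeeSkinner2022.Thm413Hypotheses N W K p κ γ),
    ¬ W.HasCM → W.HasIrreducibleModPGaloisRep p → (W.baseChange K).HasIrreducibleModPGaloisRep p →
    MastellaZerman2026.HasPadicScalarImage W p → SatisfiesHeegnerHypothesis p K →
    p ∣ NumberField.classNumber K →
    ∀ (D : (W.baseChange K).LambdaAdicSelmerData κ γ)
      (C : CastellaGrossiLeeSkinner2022.StabilizedHeegnerData N W K κ jbar)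
      (X : (W.baseChange K).SelmerDualData κ γ) (z : D.S),
    (∀ (k : ℕ) (hk : C.depth < k), D.proj k z ∈ CastellaGrossiLeeSkinner2022.stabilizedClassLayer C k hk) →
    CastellaGrossiLeeSkinner2022.stabilizedHeegnerModule D C = Submodule.span (IwasawaAlgebra p) {z} →
    Module.Finite (IwasawaAlgebra p) D.S → Module.Finite (IwasawaAlgebra p) X.X →
    Module.IsTorsion (IwasawaAlgebra p) (D.S ⧸ CastellaGrossiLeeSkinner2022.stabilizedHeegnerModule D C) →
    haveI := hyp.isElliptic
    ∃ (S : Finset (HeightOneSpectrum (𝓞 K)))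
      (hpS : ∀ v, ((p : ℕ) : 𝓞 K) ∈ v.asIdeal → v ∈ S)
      (hbad : ∀ v, v ∉ S → ((p : ℕ) : 𝓞 K) ∉ v.asIdeal → (W.baseChange K).HasGoodReductionAt v)
      (_hSN : ∀ v ∈ S, ((p : ℕ) : 𝓞 K) ∈ v.asIdeal ∨ ((N : ℕ) : 𝓞 K) ∈ v.asIdeal)
      (_hSσ : ∀ (σ : K ≃ₐ[ℚ] K) (v : HeightOneSpectrum (𝓞 K)), σ • v ∈ S → v ∈ S)
      (m₁ : ℕ), ∀ (m : ℕ) (hm : 1 ≤ m), m₁ ≤ m →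
      letI := IwasawaAlgebra.isDomain_quotient_X_pow_add_C p hm
      letI := IwasawaAlgebra.isDiscreteValuationRing_quotient_X_pow_add_C p hm
      haveI := IwasawaAlgebra.EisensteinCoeff.isLocalRing_succ p hm
      letI := IwasawaAlgebra.EisensteinCoeff.algebraOfSpecSucc p m
      haveI := W.isScalarTower_algebraOfSpecSucc (K := K) (p := p) (m := m)
      letI := W.residueModuleSucc (K := K) (p := p) hm
      ∃ (π : ∀ v : HeightOneSpectrum (𝓞 K), TamePin v) (L : Set (HeightOneSpectrum (𝓞 K)))
        (hL : L ⊆ (W.eisensteinTower (κ.unitTwist (-1)) hm).degreeTwoPrimes p) (hLS : ∀ v ∈ L, v ∉ S)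
        (s₁ : ℕ) (_hsub : ∀ v ∈ (W.eisensteinTower (κ.unitTwist (-1)) hm).kolyvaginPrimes p s₁, v ∉ S → v ∈ L)
        (t : ∀ k, ((W.baseChange K).torsionGaloisModule ((p : ℤ) ^ (k + 1))).toContRepresentation →ⁱL
          ((W.baseChange K).torsionGaloisModule ((p : ℤ) ^ k)).toContRepresentation)
        (ht : ∀ k (P : geomTorsion (W.baseChange K) ((p : ℤ) ^ (k + 1))),
          t k P = (W.baseChange K).geomTorsionReduce p k P)
        (I : ZpExtension.EisensteinH1Data (κ.unitTwist (-1))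
          (fun k ↦ (W.baseChange K).torsionGaloisModule ((p : ℤ) ^ k)) t hm)
        (jbar' : AlgebraicClosure K →+* ℂ),
        ∀ (cd : ConjugationDatum K)
          (Dd : ∀ k, DualityDatum p cd ((W.eisensteinTower (κ.unitTwist (-1)) hm).ρ k)
            (IwasawaAlgebra.EisensteinCoeff p m (k + 1)))
          (hy : (W.eisensteinDVRSettingLevelsTame (κ.unitTwist (-1)) hm π S hpS hbad L hL hLS jbar' cd Dd).SatisfiesH),
          ∃ κKS : (W.eisensteinDVRSettingLevelsTame (κ.unitTwist (-1)) hm π S hpS hbad L hL hLS jbar' cd Dd).KolyvaginSystem,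
            κKS.one ≠ 0 ∧
            ∀ k, κKS.one k = I.proj (k + 1) (D.toEisensteinH1Linear hm t ht I hyp.topGenerator hyp.noPTorsion z)

set_option synthInstance.maxHeartbeats 80000 in
/-- **Core letter of STUB A** (= the v4 letter; v5's `Stmt.howardInputs` is `thm411 → Stmt.howardInputsCore`). -/
abbrev Stmt.howardInputsCore : Prop :=
  ∀ (N : ℕ) [NeZero N] (W : WeierstrassCurve ℚ) [W.IsGloballyMinimal] (K : Type) [Field K] [NumberField K]
    (p : ℕ) [Fact p.Prime] (κ : ZpExtension K p) (γ : Field.absoluteGaloisGroup K)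
    (jbar : AlgebraicClosure K →+* ℂ) (hyp : CastellaGrossiLeeSkinner2022.Thm413Hypotheses N W K p κ γ),
    ¬ W.HasCM → W.HasIrreducibleModPGaloisRep p → (W.baseChange K).HasIrreducibleModPGaloisRep p →
    MastellaZerman2026.HasPadicScalarImage W p → SatisfiesHeegnerHypothesis p K →
    p ∣ NumberField.classNumber K →
    ∀ (D : (W.baseChange K).LambdaAdicSelmerData κ γ)
      (C : CastellaGrossiLeeSkinner2022.StabilizedHeegnerData N W K κ jbar)
      (X : (W.baseChange K).SelmerDualData κ γ) (z : D.S),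
    (∀ (k : ℕ) (hk : C.depth < k), D.proj k z ∈ CastellaGrossiLeeSkinner2022.stabilizedClassLayer C k hk) →
    CastellaGrossiLeeSkinner2022.stabilizedHeegnerModule D C = Submodule.span (IwasawaAlgebra p) {z} →
    Module.Finite (IwasawaAlgebra p) D.S → Module.Finite (IwasawaAlgebra p) X.X →
    Module.IsTorsion (IwasawaAlgebra p) (D.S ⧸ CastellaGrossiLeeSkinner2022.stabilizedHeegnerModule D C) →
    ∃ m₀ : ℕ, ∀ (m : ℕ) (hm : 1 ≤ m), m₀ ≤ m →
      haveI := hyp.isElliptic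
      letI := IwasawaAlgebra.isDomain_quotient_X_pow_add_C p hm
      letI := IwasawaAlgebra.isDiscreteValuationRing_quotient_X_pow_add_C p hm
      haveI := IwasawaAlgebra.EisensteinCoeff.isLocalRing_succ p hm
      letI := IwasawaAlgebra.EisensteinCoeff.algebraOfSpecSucc p m
      haveI := W.isScalarTower_algebraOfSpecSucc (K := K) (p := p) (m := m)
      letI := W.residueModuleSucc (K := K) (p := p) hm
      ∃ (S : Finset (IsDedekindDomain.HeightOneSpectrum (NumberField.RingOfIntegers K)))
        (hpS : ∀ v, ((p : ℕ) : NumberField.RingOfIntegers K) ∈ v.asIdeal → v ∈ S)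
        (hbad : ∀ v, v ∉ S → ((p : ℕ) : NumberField.RingOfIntegers K) ∉ v.asIdeal →
          (W.baseChange K).HasGoodReductionAt v)
        (_hSN : ∀ v ∈ S, ((p : ℕ) : NumberField.RingOfIntegers K) ∈ v.asIdeal ∨
          ((N : ℕ) : NumberField.RingOfIntegers K) ∈ v.asIdeal)
        (_hSσ : ∀ (σ : K ≃ₐ[ℚ] K) (v : IsDedekindDomain.HeightOneSpectrum (NumberField.RingOfIntegers K)),
          σ • v ∈ S → v ∈ S)
        (L : Set (IsDedekindDomain.HeightOneSpectrum (NumberField.RingOfIntegers K)))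
        (hL : L ⊆ (W.eisensteinTower (κ.unitTwist (-1)) hm).degreeTwoPrimes p)
        (hLS : ∀ v ∈ L, v ∉ S) (jbar' : AlgebraicClosure K →+* ℂ) (cd : ConjugationDatum K)
        (Dd : ∀ k, DualityDatum p cd ((W.eisensteinTower (κ.unitTwist (-1)) hm).ρ k)
          (IwasawaAlgebra.EisensteinCoeff p m (k + 1)))
        (fs : ∀ (k : ℕ) (n : Finset (IsDedekindDomain.HeightOneSpectrum (NumberField.RingOfIntegers K)))
          (v : IsDedekindDomain.HeightOneSpectrum (NumberField.RingOfIntegers K)),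
          galoisCohomology ((W.eisensteinLevelQuot (κ.unitTwist (-1)) hm k n).toLocal (Sum.inr v)) 1 →+
            SingularQuotient (GaloisRep.toLocal v (W.eisensteinLevelQuot (κ.unitTwist (-1)) hm k n)) ⊗[ℤ]
              Gell v)
        (t : ∀ k, ((W.baseChange K).torsionGaloisModule ((p : ℤ) ^ (k + 1))).toContRepresentation →ⁱL
          ((W.baseChange K).torsionGaloisModule ((p : ℤ) ^ k)).toContRepresentation)
        (ht : ∀ k (P : geomTorsion (W.baseChange K) ((p : ℤ) ^ (k + 1))),
          t k P = (W.baseChange K).geomTorsionReduce p k P)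
        (I : ZpExtension.EisensteinH1Data (κ.unitTwist (-1))
          (fun k ↦ (W.baseChange K).torsionGaloisModule ((p : ℤ) ^ k)) t hm)
        (_hy : (W.eisensteinDVRSetting (κ.unitTwist (-1)) hm S hpS hbad L hL hLS jbar' cd Dd fs).SatisfiesH)
        (κKS : (W.eisensteinDVRSetting (κ.unitTwist (-1)) hm S hpS hbad L hL hLS jbar' cd Dd fs).KolyvaginSystem),
        (W.eisensteinDVRSetting (κ.unitTwist (-1)) hm S hpS hbad L hL hLS jbar' cd Dd fs).LargePrimes ∧
        κKS.one ≠ 0 ∧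
        ∀ k, κKS.one k = I.proj (k + 1) (D.toEisensteinH1Linear hm t ht I hyp.topGenerator hyp.noPTorsion z)

set_option synthInstance.maxHeartbeats 80000 in
/-- **STUB A's letter** `Stmt.howardInputs` of the registered skeleton v8 (GIVEN CGLS22 Thm. 4.1.1 by name), `ctrlLevel` inlined. -/
abbrev Stmt.howardInputs : Prop :=
  Literature.NumberTheory.EllipticCurves.CastellaGrossiLeeSkinner2022.thm411_exists_kolyvaginSystem_one_ne_zero →
  ∀ (N : ℕ) [NeZero N] (W : WeierstrassCurve ℚ) [W.IsGloballyMinimal] (K : Type) [Field K] [NumberField K]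
    (p : ℕ) [Fact p.Prime] (κ : ZpExtension K p) (γ : Field.absoluteGaloisGroup K)
    (jbar : AlgebraicClosure K →+* ℂ) (hyp : CastellaGrossiLeeSkinner2022.Thm413Hypotheses N W K p κ γ),
    ¬ W.HasCM → W.HasIrreducibleModPGaloisRep p → (W.baseChange K).HasIrreducibleModPGaloisRep p →
    MastellaZerman2026.HasPadicScalarImage W p → SatisfiesHeegnerHypothesis p K →
    p ∣ NumberField.classNumber K →
    ∀ (D : (W.baseChange K).LambdaAdicSelmerData κ γ)
      (C : CastellaGrossiLeeSkinner2022.StabilizedHeegnerData N W K κ jbar)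
      (X : (W.baseChange K).SelmerDualData κ γ) (z : D.S),
    (∀ (k : ℕ) (hk : C.depth < k), D.proj k z ∈ CastellaGrossiLeeSkinner2022.stabilizedClassLayer C k hk) →
    CastellaGrossiLeeSkinner2022.stabilizedHeegnerModule D C = Submodule.span (IwasawaAlgebra p) {z} →
    Module.Finite (IwasawaAlgebra p) D.S → Module.Finite (IwasawaAlgebra p) X.X →
    Module.IsTorsion (IwasawaAlgebra p) (D.S ⧸ CastellaGrossiLeeSkinner2022.stabilizedHeegnerModule D C) →
    ∃ m₀ : ℕ, ∀ (m : ℕ) (hm : 1 ≤ m), m₀ ≤ m →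
      haveI := hyp.isElliptic
      letI := IwasawaAlgebra.isDomain_quotient_X_pow_add_C p hm
      letI := IwasawaAlgebra.isDiscreteValuationRing_quotient_X_pow_add_C p hm
      haveI := IwasawaAlgebra.EisensteinCoeff.isLocalRing_succ p hm
      letI := IwasawaAlgebra.EisensteinCoeff.algebraOfSpecSucc p m
      haveI := W.isScalarTower_algebraOfSpecSucc (K := K) (p := p) (m := m)
      letI := W.residueModuleSucc (K := K) (p := p) hm
      ∃ (S : Finset (IsDedekindDomain.HeightOneSpectrum (NumberField.RingOfIntegers K)))
        (hpS : ∀ v, ((p : ℕ) : NumberField.RingOfIntegers K) ∈ v.asIdeal → v ∈ S)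
        (hbad : ∀ v, v ∉ S → ((p : ℕ) : NumberField.RingOfIntegers K) ∉ v.asIdeal →
          (W.baseChange K).HasGoodReductionAt v)
        (_hSN : ∀ v ∈ S, ((p : ℕ) : NumberField.RingOfIntegers K) ∈ v.asIdeal ∨
          ((N : ℕ) : NumberField.RingOfIntegers K) ∈ v.asIdeal)
        (_hSσ : ∀ (σ : K ≃ₐ[ℚ] K) (v : IsDedekindDomain.HeightOneSpectrum (NumberField.RingOfIntegers K)),
          σ • v ∈ S → v ∈ S)
        (L : Set (IsDedekindDomain.HeightOneSpectrum (NumberField.RingOfIntegers K)))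
        (hL : L ⊆ (W.eisensteinTower (κ.unitTwist (-1)) hm).degreeTwoPrimes p)
        (hLS : ∀ v ∈ L, v ∉ S) (jbar' : AlgebraicClosure K →+* ℂ) (cd : ConjugationDatum K)
        (Dd : ∀ k, DualityDatum p cd ((W.eisensteinTower (κ.unitTwist (-1)) hm).ρ k)
          (IwasawaAlgebra.EisensteinCoeff p m (k + 1)))
        (fs : ∀ (k : ℕ) (n : Finset (IsDedekindDomain.HeightOneSpectrum (NumberField.RingOfIntegers K)))
          (v : IsDedekindDomain.HeightOneSpectrum (NumberField.RingOfIntegers K)),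
          galoisCohomology ((W.eisensteinLevelQuot (κ.unitTwist (-1)) hm k n).toLocal (Sum.inr v)) 1 →+
            SingularQuotient (GaloisRep.toLocal v (W.eisensteinLevelQuot (κ.unitTwist (-1)) hm k n)) ⊗[ℤ]
              Gell v)
        (t : ∀ k, ((W.baseChange K).torsionGaloisModule ((p : ℤ) ^ (k + 1))).toContRepresentation →ⁱL
          ((W.baseChange K).torsionGaloisModule ((p : ℤ) ^ k)).toContRepresentation)
        (ht : ∀ k (P : geomTorsion (W.baseChange K) ((p : ℤ) ^ (k + 1))),
          t k P = (W.baseChange K).geomTorsionReduce p k P)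
        (I : ZpExtension.EisensteinH1Data (κ.unitTwist (-1))
          (fun k ↦ (W.baseChange K).torsionGaloisModule ((p : ℤ) ^ k)) t hm)
        (_hy : (W.eisensteinDVRSetting (κ.unitTwist (-1)) hm S hpS hbad L hL hLS jbar' cd Dd fs).SatisfiesH)
        (κKS : (W.eisensteinDVRSetting (κ.unitTwist (-1)) hm S hpS hbad L hL hLS jbar' cd Dd fs).KolyvaginSystem),
        (W.eisensteinDVRSetting (κ.unitTwist (-1)) hm S hpS hbad L hL hLS jbar' cd Dd fs).LargePrimes ∧
        κKS.one ≠ 0 ∧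
        ∀ k, κKS.one k = I.proj (k + 1) (D.toEisensteinH1Linear hm t ht I hyp.topGenerator hyp.noPTorsion z)

set_option synthInstance.maxHeartbeats 80000 in
set_option maxHeartbeats 1600000 in
/-- **STUB A (core letter) from the four inputs** (D1 LEAD g8's `obtain` chain v3, VERBATIM but for the two exported
place-set binders `hSN`/`hSσ`). -/
theorem howardInputs_of_clauses (hPT : HeegnerMuPartH4AtS.Stmt.poitouTate) (H4 : HeegnerMuPartH4AtS.Stmt.h4AtS) (H5 : Stmt.h5bAtS)
    (KS : Stmt.ksLink) : Stmt.howardInputsCore := by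
  intro N _ W _ K _ _ p _ κ γ jbar hyp hCM hirr hirrK hsc hHp hhK D C X z hz hcyc hfinS hfinX htor
  haveI := hyp.isElliptic
  -- the KS side's set of places `S` (above `p` and `N`, `Aut(K/ℚ)`-stable) and its threshold `m₁`
  obtain ⟨S, hpS, hbad, hSN, hSσ, m₁, hKS⟩ :=
    KS N W K p κ γ jbar hyp hCM hirr hirrK hsc hHp hhK D C X z hz hcyc hfinS hfinX htor
  obtain ⟨m₄, hH4⟩ := H4 N W K p κ γ hyp hirr hirrK S hpS hbad hSN hSσ
  obtain ⟨m₅, hH5⟩ := H5 N W K p κ γ hyp hirr hirrK S hpS hbad hSN hSσ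
  refine ⟨max (max m₁ m₄) m₅, fun m hm hle ↦ ?_⟩
  have hm1 : m₁ ≤ m := le_trans ((le_max_left _ _).trans (le_max_left _ _)) hle
  have hm4 : m₄ ≤ m := le_trans ((le_max_right _ _).trans (le_max_left _ _)) hle
  have hm5 : m₅ ≤ m := le_trans (le_max_right _ _) hle
  letI := IwasawaAlgebra.isDomain_quotient_X_pow_add_C p hm
  letI := IwasawaAlgebra.isDiscreteValuationRing_quotient_X_pow_add_C p hm
  haveI := IwasawaAlgebra.EisensteinCoeff.isLocalRing_succ p hm
  letI := IwasawaAlgebra.EisensteinCoeff.algebraOfSpecSucc p m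
  haveI := W.isScalarTower_algebraOfSpecSucc (K := K) (p := p) (m := m)
  letI := W.residueModuleSucc (K := K) (p := p) hm
  -- the KS side's choices at `m`
  obtain ⟨π, L, hL, hLS, s₁, hsub, t, ht, I, jbar', hKSm⟩ := hKS m hm hm1
  -- D1: conjugation datum, H.4 data, `SatisfiesH` modulo the `v ∈ S` clauses
  obtain ⟨c₀, σ, hσ₁, hσ, hτl, hτ₂, Dd, e, log, hc₀, hτ, hDe, he_red, h4', h5', h6', h7', h8', h9', hyOf⟩ :=
    HeegnerMuPartHowardSettingERed.exists_eisensteinSettingData_satisfiesH_eRed_of_thm413Hypotheses hyp hirr hirrK (hPT K)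
      (-1) hm π S hpS hbad hSσ L hL hLS jbar'
  have hfin4 := hH4 m hm hm4 L hL hLS c₀ σ hσ₁ hσ hτl hτ₂ Dd e log hc₀ hτ hDe he_red h4' h5' h6' h7' h8' h9'
  have hfin5b := hH5 m hm hm5 π L hL hLS jbar' c₀ σ hσ₁ hσ hτl hτ₂ Dd e log hc₀ hτ hDe he_red h4' h5' h6' h7' h8' h9'
  have hy := hyOf hfin4 hfin5b
  obtain ⟨κKS, hone, hlink⟩ := hKSm _ Dd hy
  have hLP := W.eisensteinDVRSetting_largePrimes (κ.unitTwist (-1)) hm S hpS hbad L hL hLS jbar' _ Dd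
    (W.eisensteinLevelsTameFs (κ.unitTwist (-1)) hm π S hpS hbad L hL hLS) hsub
  exact ⟨S, hpS, hbad, hSN, hSσ, L, hL, hLS, jbar', _, Dd, W.eisensteinLevelsTameFs (κ.unitTwist (-1)) hm π S hpS hbad L hL hLS,
    t, ht, I, hy, κKS, hLP, hone, hlink⟩


/-- **STUB A of skeleton v8 from its two registered stubs** (and CGLS Thm. 4.1.1 by name): (Exact) at `v ∣ p` and the
level-`0` clause of H.5(b) at `v ∣ p` give `Stmt.howardInputs` — Poitou–Tate, H.4 ⟸ (Exact), H.5(b) ⟸ level `0`, the KS-LINK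
and D1's chain are all kernel theorems. -/
theorem howardInputs_of_exactAtP_of_clauseZeroP (HE : HeegnerMuPartH4AtS.Stmt.exactAtP) (H5P : Stmt.h5bAtSZeroP) :
    Stmt.howardInputs := fun hK ↦
  howardInputs_of_clauses HeegnerMuPartH4AtS.poitouTate_holds (HeegnerMuPartH4AtS.h4AtS_of_exactAtP' HE)
    (HeegnerMuPartH5bAtS.h5bAtSERed_of_clauseZeroP H5P) (HeegnerMuPartKSLink.ksLink_of_thm411 hK)

end Summit.BirchSwinnertonDyer.BirchSwinnertonDyer.Theorems.HeegnerMuPartStubA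

end
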